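import Mathlib.LinearAlgebra.FiniteDimensional.Lemmas
import Literature.InformationTheory.QuantumCodes.HypergraphProduct
import HarnessLib

/-!
# CSS codes from a pair of binary check matrices: `d_X`, `d_Z`, `k`, and the membership lemmas
# a distance certificate is checked against

A Calderbank–Shor–Steane (CSS) code is presented, as in Bravyi–Cross–Gambetta–Maslov–Rall–Yoder
2024 §4 and Nielsen–Chuang eq. (10.106), by two binary *check matrices* `H^X` (rows = `X`-type
stabilizer generators) and `H^Z` (rows = `Z`-type generators) on a finite qubit set `Q`, subject to
the commutation condition `H^X (H^Z)ᵀ = 0`. In the language of two classical codes (Calderbank–Shor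
1996 §3 `{0} ⊂ C₂ ⊂ C₁`; Steane 1996 Thm. 5; Nielsen–Chuang §10.4.2 `CSS(C₁, C₂)` with `C₂ ⊂ C₁`):
`C₁ = ker H^Z`, `C₂ = rs H^X` (row space), `C₂^⊥ = ker H^X`, `C₁^⊥ = rs H^Z`, and
`H^X (H^Z)ᵀ = 0 ⟺ rs H^X ⊆ ker H^Z ⟺ C₂ ⊆ C₁` ("the dual code of each code must be a subset of the
other code", Gottesman 1997 §3.3). (CRSS 1998 Thm. 9 writes the same pair as `C₁ ⊆ C₂` with the
roles of the indices exchanged; see `SymplecticCodes.cssSpace`.)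

This file (LADDER-QEC PARTITION row type-02) adds, on top of the tree's `pcCode H = ker H`,
`rowSpace H = rs H` and `cssMinDist` (`HypergraphProduct.lean`, row type-04) and Mathlib's
`Matrix.rank`, `hammingNorm`:

* binary check-matrix lemmas: `mem_rowSpace_of_vecMul_eq` (membership witness `v = cᵀH`),
  **`not_mem_rowSpace_of_witness`** (`H u = 0 ∧ ⟨u, v⟩ ≠ 0 ⟹ v ∉ rs H` — the non-membership witness
  a distance certificate carries), `finrank_rowSpace_eq_rank`, `rank_add_finrank_pcCode`
  (rank–nullity), `rank_add_rank_le_of_rowSpace_le_pcCode`;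
* `CSSCode RX RZ Q` — the structure `(H^X, H^Z, H^X (H^Z)ᵀ = 0)`; `CSSCode.ofMatrices`; `CSSCode.swap`
  (the `X ↔ Z` exchange — every `Z`-side statement is the `X`-side statement of the swap); the four
  classical codes `kerX = ker H^X`, `kerZ = ker H^Z`, `rowSpX = rs H^X`, `rowSpZ = rs H^Z` with
  `rowSpX ≤ kerZ`, `rowSpZ ≤ kerX`;
* the **`X`- and `Z`-distances** `dX = min {|v| : v ∈ ker H^Z ∖ rs H^X}`,
  `dZ = min {|v| : v ∈ ker H^X ∖ rs H^Z}` (Bravyi et al. 2024 §4, proof of Lemma 1, verbatim;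
  Steane 1996 Thm. 5 "minimum distance `d₁` in one basis and `d₂` in the other"), valued in `ℕ` with
  the DOCUMENTED JUNK VALUE `0` when the set is empty (no logical operator of that type ⟺ `k = 0`,
  `dX_eq_zero_iff`, `k_eq_zero_iff_dX_eq_zero`); `|v|` is Mathlib's `hammingNorm v`;
* their certificate interface: `dX_le_hammingNorm` (an explicit logical bounds `dX` above), `le_dX`
  (a universally checked lower bound), **`dX_eq_of_witness`** (both: THE lemma a certificate
  `(v, d, "no X-logical of weight < d")` discharges), `exists_hammingNorm_eq_dX`, `dX_pos_iff`;
* the number of logical qubits `k = dim (ker H^Z) − dim (rs H^X)` (Nielsen–Chuang's `k₁ − k₂`) with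
  the printed closed form **`k = n − rank H^X − rank H^Z` PROVED** (`k_eq`; Bravyi et al. 2024 proof
  of Lemma 1 citing Steane 1996 / Calderbank–Shor 1996) and `rank H^X + rank H^Z ≤ n` (no truncated
  subtraction), `k_swap` (counting `Z`-logicals gives the same `k`);
* the link to Tillich–Zémor's `ℕ∞`-valued `cssMinDist` of `HypergraphProduct.lean`:
  `cssMinDist H^X H^Z = min dX dZ` when `k > 0` and `= ⊤` when `k = 0` (`cssMinDist_eq_min_dX_dZ`,
  `cssMinDist_eq_top`), so both rows speak about one object.

The symplectic (stabilizer) side — the additive code `rs H^X × rs H^Z ≤ 𝔽₂ⁿ × 𝔽₂ⁿ`, its minimum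
distance `min wt (S̄⊥ ∖ S̄)` (Nielsen–Chuang §10.5.5) and the folklore lemma `distance = min (dX, dZ)`
— is `QuantumCodes/CSSDistance.lean`; decoders and thresholds are not here.

## References (locators read on the page)

* [BravyiEtAl2024] S. Bravyi, A. W. Cross, J. M. Gambetta, D. Maslov, P. Rall, T. J. Yoder,
  *High-threshold and low-overhead fault-tolerant quantum memory*, Nature 627 (2024) 778–782 =
  arXiv:2308.07915, §4, Lemma 1 and its proof: "a CSS code with check matrices `H^X` and `H^Z` has
  distance `d = min(d^X, d^Z)` where `d^X = min{|v| : v ∈ ker H^Z ∖ rs H^X}` and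
  `d^Z = min{|v| : v ∈ ker H^X ∖ rs H^Z}`"; "`k = n − rk H^X − rk H^Z`" (held text
  paper:arxiv-2308.07915, chunk p0009 L63–L117).
* [NielsenChuang2010] M. A. Nielsen, I. L. Chuang, *Quantum Computation and Quantum Information*,
  10th anniversary ed., CUP 2010: §10.4.1 p. 448 (code of a parity check matrix), §10.4.2 p. 450
  (`CSS(C₁,C₂)`, `C₂ ⊂ C₁`, an `[n, k₁ − k₂]` code); §10.5.6 pp. 469–470, eq. (10.106) (check matrix
  `[H(C₂^⊥) 0; 0 H(C₁)]`, `H(C₂^⊥) H(C₁)ᵀ = 0`).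
* [Gottesman1997] D. Gottesman, *Stabilizer Codes and Quantum Error Correction*, Caltech PhD thesis
  1997 = arXiv:quant-ph/9705052, §3.3 (CSS codes from parity check matrices `P`, `Q`), §3.4.
* [CalderbankEtAl1998] A. R. Calderbank, E. M. Rains, P. W. Shor, N. J. A. Sloane, IEEE Trans. IT 44
  (1998) 1369, Thm. 9 (CSS construction in the symplectic language) — see `SymplecticCodes.lean`.
* Originators, cited through the above: A. R. Calderbank, P. W. Shor, Phys. Rev. A 54 (1996) 1098 =
  arXiv:quant-ph/9512032, §3; A. M. Steane, Proc. R. Soc. A 452 (1996) 2551 = arXiv:quant-ph/9601029,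
  Thm. 5.

## Mathlib / tree search (2026-08-26)

`lean search` for CSS / stabilizer code / logical operator / code distance: the tree has `pcCode`,
`rowSpace`, `cssMinDist` (`QuantumCodes/HypergraphProduct.lean`), the symplectic predicates
`HasMinDist`, `IsAdditiveCode`, `cssSpace` (`QuantumCodes/SymplecticCodes.lean`) and classical
`Coding.minDist/dualCode` (`Coding/DualDistance.lean`); Mathlib has `hammingNorm`, `Matrix.rank`,
`range_vecMulLinear`, `LinearMap.finrank_range_add_finrank_ker`. Nothing is re-defined here.
-/

namespace Literature.InformationTheory.QuantumCodes

open Matrix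

/-! ### Binary check matrices: witnesses for (non-)membership in a row space; rank–nullity -/

section CheckMatrix

variable {R Q : Type*} [Fintype R] [Fintype Q]

omit [Fintype Q] in
/-- **Membership witness**: `cᵀ H ∈ rs H` — a row-combination certificate `c` with `cᵀ H = v` proves
`v ∈ rs H`. [cite: NielsenChuang2010, §10.4.1 p. 449 (the dual C^⊥ of C = ker H has generator matrix Hᵀ, i.e. is the row space of H; "all y orthogonal to all the codewords")] -/
theorem mem_rowSpace_of_vecMul_eq {H : Matrix R Q (ZMod 2)} {v : Q → ZMod 2} (c : R → ZMod 2)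
    (hc : c ᵥ* H = v) : v ∈ rowSpace H :=
  (mem_rowSpace_iff H v).2 ⟨c, hc⟩

/-- Row-space vectors are orthogonal to kernel vectors: `v ∈ rs H`, `H u = 0 ⟹ ⟨u, v⟩ = 0`.
[cite: NielsenChuang2010, §10.4.1 p. 449 (the dual C^⊥ of C = ker H has generator matrix Hᵀ, i.e. is the row space of H; "all y orthogonal to all the codewords")] -/
theorem dotProduct_eq_zero_of_mem_rowSpace {H : Matrix R Q (ZMod 2)} {u v : Q → ZMod 2}
    (hv : v ∈ rowSpace H) (hu : H *ᵥ u = 0) : u ⬝ᵥ v = 0 := by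
  obtain ⟨c, rfl⟩ := (mem_rowSpace_iff H v).1 hv
  rw [dotProduct_comm, ← dotProduct_mulVec, hu, dotProduct_zero]

/-- **Non-membership witness** — the fact a distance certificate's entry "this logical operator is
not a stabilizer" is checked against: if `H u = 0` and `⟨u, v⟩ ≠ 0` (i.e. `= 1` over `𝔽₂`) then
`v ∉ rs H`. For a CSS code: an `X`-type operator `X(v)` anticommuting with some `Z`-type operator
`Z(u)` that commutes with all `X`-checks (`H^X u = 0`) is not a product of `X`-checks. [cite: BravyiEtAl2024, §6 (arXiv chunk p0017 L50-66: "d(η) ≥ d for any logical operator X(η)" — a kernel vector with odd overlap is a logical, not a stabilizer)] -/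
theorem not_mem_rowSpace_of_witness {H : Matrix R Q (ZMod 2)} {v : Q → ZMod 2} (u : Q → ZMod 2)
    (hu : H *ᵥ u = 0) (huv : u ⬝ᵥ v ≠ 0) : v ∉ rowSpace H :=
  fun hv => huv (dotProduct_eq_zero_of_mem_rowSpace hv hu)

/-- `dim (rs H) = rank H` (row rank = rank: Mathlib's `Matrix.rank_eq_finrank_span_row` and
`range_vecMulLinear`). [cite: NielsenChuang2010, §10.4.1 p. 449 (the dual C^⊥ of C = ker H has generator matrix Hᵀ, i.e. is the row space of H; "all y orthogonal to all the codewords")] -/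
theorem finrank_rowSpace_eq_rank (H : Matrix R Q (ZMod 2)) :
    Module.finrank (ZMod 2) (rowSpace H) = H.rank := by
  have h1 : rowSpace H = Submodule.span (ZMod 2) (Set.range H.row) := range_vecMulLinear H
  rw [h1]
  exact (Matrix.rank_eq_finrank_span_row H).symm

omit [Fintype R] in
/-- Rank–nullity for a check matrix: `rank H + dim (ker H) = |Q|`. [cite: NielsenChuang2010, §10.4.1 p. 448 eq. (10.57) (the code of H is the kernel Hx = 0; "the kernel of H must be k-dimensional")] -/
theorem rank_add_finrank_pcCode (H : Matrix R Q (ZMod 2)) :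
    H.rank + Module.finrank (ZMod 2) (pcCode H) = Fintype.card Q := by
  have h := LinearMap.finrank_range_add_finrank_ker (K := ZMod 2) H.mulVecLin
  rw [Module.finrank_fintype_fun_eq_card] at h
  exact h

/-- If `rs A ≤ ker B` (e.g. `A Bᵀ = 0`) then `rank A ≤ dim (ker B)`, hence `rank A + rank B ≤ |Q|`.
[cite: NielsenChuang2010, §10.4.2 p. 450 (C₂ ⊂ C₁, an [n, k₁ − k₂] code)] -/
theorem rank_add_rank_le_of_rowSpace_le_pcCode {R' : Type*} {A : Matrix R Q (ZMod 2)}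
    {B : Matrix R' Q (ZMod 2)} (h : rowSpace A ≤ pcCode B) : A.rank + B.rank ≤ Fintype.card Q := by
  have h1 : A.rank ≤ Module.finrank (ZMod 2) (pcCode B) := by
    rw [← finrank_rowSpace_eq_rank]
    exact Submodule.finrank_mono h
  have h2 := rank_add_finrank_pcCode B
  omega

end CheckMatrix

/-! ### CSS codes presented by check matrices -/

/-- A **CSS code** on the qubit set `Q`, presented by its binary check matrices: `HX` (rows `RX` = the
`X`-type stabilizer generators `X(r)`) and `HZ` (rows `RZ` = the `Z`-type generators `Z(r)`), with the
commutation condition `HX * HZᵀ = 0` (every `X`-row has even overlap with every `Z`-row).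
Nielsen–Chuang's `CSS(C₁, C₂)` (`C₂ ⊂ C₁`) is the case `HX = H(C₂^⊥)` (a generator matrix of `C₂`),
`HZ = H(C₁)`. Redundant (linearly dependent) rows are allowed.
[cite: NielsenChuang2010, §10.5.6 eq. (10.106) (pp. 469–470)] [cite: BravyiEtAl2024, §4 (check matrices H^X, H^Z)] -/
structure CSSCode (RX RZ Q : Type*) [Fintype Q] where
  /-- the `X`-check matrix `H^X` -/
  HX : Matrix RX Q (ZMod 2)
  /-- the `Z`-check matrix `H^Z` -/
  HZ : Matrix RZ Q (ZMod 2)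
  /-- commutation of `X`- and `Z`-checks: `H^X (H^Z)ᵀ = 0` -/
  comm : HX * HZᵀ = 0

namespace CSSCode

variable {RX RZ Q : Type*} [Fintype Q]

/-- The CSS code with check matrices `HX`, `HZ` satisfying `HX * HZᵀ = 0` (PARTITION name
`CSS.ofMatrices`). [cite: NielsenChuang2010, §10.5.6 eq. (10.106)] -/
abbrev ofMatrices (HX : Matrix RX Q (ZMod 2)) (HZ : Matrix RZ Q (ZMod 2)) (h : HX * HZᵀ = 0) :
    CSSCode RX RZ Q :=
  ⟨HX, HZ, h⟩

/-- The **`X ↔ Z` exchange** of a CSS code (conjugation by transversal Hadamard): swap the two check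
matrices. Every `Z`-side notion below is, by definition, the `X`-side notion of the swap. [cite: Gottesman1997, §3.3 (the two parity check matrices P (Z's) and Q ("only now with X's instead of Z's") enter symmetrically)] -/
def swap (C : CSSCode RX RZ Q) : CSSCode RZ RX Q where
  HX := C.HZ
  HZ := C.HX
  comm := by
    have h := congrArg Matrix.transpose C.comm
    rwa [Matrix.transpose_mul, Matrix.transpose_transpose, Matrix.transpose_zero] at h

/-- `(swap C).HX = C.HZ`. [cite: Gottesman1997, §3.3 (the two parity check matrices P (Z's) and Q ("only now with X's instead of Z's") enter symmetrically)] -/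
@[simp] theorem swap_HX (C : CSSCode RX RZ Q) : C.swap.HX = C.HZ := rfl

/-- `(swap C).HZ = C.HX`. [cite: Gottesman1997, §3.3 (the two parity check matrices P (Z's) and Q ("only now with X's instead of Z's") enter symmetrically)] -/
@[simp] theorem swap_HZ (C : CSSCode RX RZ Q) : C.swap.HZ = C.HX := rfl

/-- The exchange is an involution. [cite: Gottesman1997, §3.3 (the two parity check matrices P (Z's) and Q ("only now with X's instead of Z's") enter symmetrically)] -/
@[simp] theorem swap_swap (C : CSSCode RX RZ Q) : C.swap.swap = C := by
  cases C; rfl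

/-- `H^Z (H^X)ᵀ = 0` (transpose of the commutation condition). [cite: NielsenChuang2010, §10.5.6 eq. (10.106) (pp. 469–470)] -/
theorem HZ_mul_HX_transpose (C : CSSCode RX RZ Q) : C.HZ * C.HXᵀ = 0 := C.swap.comm

/-- `ker H^X`: the binary vectors `b` with `H^X b = 0`, i.e. the `Z`-type operators `Z(b)` commuting
with every `X`-check (Nielsen–Chuang's `C₂^⊥`). [cite: BravyiEtAl2024, §4 proof of Lemma 1 (ker H^X)] -/
abbrev kerX (C : CSSCode RX RZ Q) : Submodule (ZMod 2) (Q → ZMod 2) := pcCode C.HX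

/-- `ker H^Z`: the binary vectors `a` with `H^Z a = 0`, i.e. the `X`-type operators `X(a)` commuting
with every `Z`-check (Nielsen–Chuang's `C₁`). [cite: BravyiEtAl2024, §4 proof of Lemma 1 (ker H^Z)] -/
abbrev kerZ (C : CSSCode RX RZ Q) : Submodule (ZMod 2) (Q → ZMod 2) := pcCode C.HZ

/-- `rs H^X`: the row space of `H^X`, i.e. the `X`-type stabilizer elements `X(cᵀH^X)` (Nielsen–Chuang's
`C₂`). [cite: BravyiEtAl2024, §4 proof of Lemma 1 (rs H^X)] -/
abbrev rowSpX [Fintype RX] (C : CSSCode RX RZ Q) : Submodule (ZMod 2) (Q → ZMod 2) := rowSpace C.HX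

/-- `rs H^Z`: the row space of `H^Z`, i.e. the `Z`-type stabilizer elements (Nielsen–Chuang's `C₁^⊥`).
[cite: BravyiEtAl2024, §4 proof of Lemma 1 (rs H^Z)] -/
abbrev rowSpZ [Fintype RZ] (C : CSSCode RX RZ Q) : Submodule (ZMod 2) (Q → ZMod 2) := rowSpace C.HZ

/-- `v ∈ ker H^Z ↔ H^Z v = 0`. [cite: NielsenChuang2010, §10.4.1 p. 448 eq. (10.57) (the code of H is the kernel Hx = 0; "the kernel of H must be k-dimensional")] -/
theorem mem_kerZ_iff (C : CSSCode RX RZ Q) (v : Q → ZMod 2) : v ∈ C.kerZ ↔ C.HZ *ᵥ v = 0 := Iff.rfl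

/-- `v ∈ ker H^X ↔ H^X v = 0`. [cite: NielsenChuang2010, §10.4.1 p. 448 eq. (10.57) (the code of H is the kernel Hx = 0; "the kernel of H must be k-dimensional")] -/
theorem mem_kerX_iff (C : CSSCode RX RZ Q) (v : Q → ZMod 2) : v ∈ C.kerX ↔ C.HX *ᵥ v = 0 := Iff.rfl

/-- `X`-stabilizers commute with the `Z`-checks: `rs H^X ≤ ker H^Z` (from `H^X (H^Z)ᵀ = 0`; this is
Nielsen–Chuang's `C₂ ⊂ C₁`).
[cite: NielsenChuang2010, §10.5.6 (H(C₂^⊥)H(C₁)ᵀ = [H(C₁)G(C₂)]ᵀ = 0 "because of the assumption C₂ ⊂ C₁")] -/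
theorem rowSpX_le_kerZ [Fintype RX] (C : CSSCode RX RZ Q) : C.rowSpX ≤ C.kerZ := by
  intro v hv
  obtain ⟨c, rfl⟩ := (mem_rowSpace_iff C.HX v).1 hv
  rw [mem_kerZ_iff, Matrix.mulVec_vecMul, C.HZ_mul_HX_transpose, Matrix.zero_mulVec]

/-- `Z`-stabilizers commute with the `X`-checks: `rs H^Z ≤ ker H^X`. [cite: NielsenChuang2010, §10.5.6 eq. (10.106) (pp. 469–470)] -/
theorem rowSpZ_le_kerX [Fintype RZ] (C : CSSCode RX RZ Q) : C.rowSpZ ≤ C.kerX :=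
  C.swap.rowSpX_le_kerZ

/-! ### The `X`- and `Z`-distances -/

section Distances

/-- The **`X`-distance** `d^X = min {|v| : v ∈ ker H^Z ∖ rs H^X}`: the least Hamming weight of an
`X`-type logical operator `X(v)` (commutes with every `Z`-check and is not a product of `X`-checks).
Valued in `ℕ`; JUNK VALUE: `d^X = 0` exactly when `ker H^Z = rs H^X`, i.e. when the code has no
`X`-type logical operator (`k = 0`; `dX_eq_zero_iff`, `k_eq_zero_iff_dX_eq_zero`) — a nonempty
`ker H^Z ∖ rs H^X` consists of nonzero vectors, so `d^X ≥ 1` there (`dX_pos_iff`).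
[cite: BravyiEtAl2024, §4, proof of Lemma 1 ("d^X = min{|v| : v ∈ ker H^Z ∖ rs H^X}")] -/
noncomputable def dX [Fintype RX] (C : CSSCode RX RZ Q) : ℕ :=
  sInf (hammingNorm '' ((C.kerZ : Set (Q → ZMod 2)) \ C.rowSpX))

/-- The **`Z`-distance** `d^Z = min {|v| : v ∈ ker H^X ∖ rs H^Z}` (least weight of a `Z`-type logical
operator); by definition the `X`-distance of the `X ↔ Z` exchange; junk value `0` when `ker H^X = rs H^Z`.
[cite: BravyiEtAl2024, §4, proof of Lemma 1 ("d^Z = min{|v| : v ∈ ker H^X ∖ rs H^Z}")] -/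
noncomputable def dZ [Fintype RZ] (C : CSSCode RX RZ Q) : ℕ := C.swap.dX

/-- `d^Z` unfolded: `sInf` of the weights over `ker H^X ∖ rs H^Z`.
[cite: BravyiEtAl2024, §4, proof of Lemma 1] -/
theorem dZ_eq [Fintype RZ] (C : CSSCode RX RZ Q) :
    C.dZ = sInf (hammingNorm '' ((C.kerX : Set (Q → ZMod 2)) \ C.rowSpZ)) := rfl

/-- `dX (swap C) = dZ C`. [cite: Gottesman1997, §3.3 (the two parity check matrices P (Z's) and Q ("only now with X's instead of Z's") enter symmetrically)] -/
@[simp] theorem dX_swap [Fintype RZ] (C : CSSCode RX RZ Q) : C.swap.dX = C.dZ := rfl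

/-- `dZ (swap C) = dX C`. [cite: Gottesman1997, §3.3 (the two parity check matrices P (Z's) and Q ("only now with X's instead of Z's") enter symmetrically)] -/
@[simp] theorem dZ_swap [Fintype RX] (C : CSSCode RX RZ Q) : C.swap.dZ = C.dX := by
  rw [dZ, swap_swap]

/-- **Upper bound by an explicit logical**: if `H^Z v = 0` and `v ∉ rs H^X` then `d^X ≤ |v|`.
[cite: BravyiEtAl2024, §4, proof of Lemma 1] -/
theorem dX_le_hammingNorm [Fintype RX] (C : CSSCode RX RZ Q) {v : Q → ZMod 2} (hv : C.HZ *ᵥ v = 0)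
    (hv' : v ∉ C.rowSpX) : C.dX ≤ hammingNorm v :=
  Nat.sInf_le ⟨v, ⟨hv, hv'⟩, rfl⟩

/-- `Z`-side upper bound: `H^X v = 0`, `v ∉ rs H^Z ⟹ d^Z ≤ |v|`.
[cite: BravyiEtAl2024, §4, proof of Lemma 1] -/
theorem dZ_le_hammingNorm [Fintype RZ] (C : CSSCode RX RZ Q) {v : Q → ZMod 2} (hv : C.HX *ᵥ v = 0)
    (hv' : v ∉ C.rowSpZ) : C.dZ ≤ hammingNorm v :=
  C.swap.dX_le_hammingNorm hv hv'

/-- A vector outside `rs H^X` is nonzero, so it has positive weight. [cite: BravyiEtAl2024, §4 Lemma 1 and proof (arXiv chunk p0009 L109-117: d^X, d^Z as minima over ker ∖ rs)] -/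
theorem hammingNorm_pos_of_not_mem_rowSpX [Fintype RX] (C : CSSCode RX RZ Q) {v : Q → ZMod 2}
    (hv' : v ∉ C.rowSpX) : 0 < hammingNorm v := by
  rw [hammingNorm_pos_iff]
  rintro rfl
  exact hv' (Submodule.zero_mem _)

/-- **Lower bound, checked universally**: if some `X`-logical exists and every `X`-logical has weight
`≥ d`, then `d ≤ d^X`. (The existence hypothesis only guards the junk value.) [cite: Gottesman1997, §3.2 ("the code will have distance d iff N(S) − S contains no elements of weight less than d")] -/
theorem le_dX [Fintype RX] (C : CSSCode RX RZ Q) {d : ℕ} (hex : ∃ v : Q → ZMod 2, C.HZ *ᵥ v = 0 ∧ v ∉ C.rowSpX)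
    (h : ∀ v : Q → ZMod 2, C.HZ *ᵥ v = 0 → v ∉ C.rowSpX → d ≤ hammingNorm v) : d ≤ C.dX := by
  obtain ⟨v, hv, hv'⟩ := hex
  refine le_csInf ⟨_, v, ⟨hv, hv'⟩, rfl⟩ ?_
  rintro _ ⟨w, ⟨hw, hw'⟩, rfl⟩
  exact h w hw hw'

/-- `Z`-side lower bound. [cite: Gottesman1997, §3.2 ("the code will have distance d iff N(S) − S contains no elements of weight less than d")] -/
theorem le_dZ [Fintype RZ] (C : CSSCode RX RZ Q) {d : ℕ} (hex : ∃ v : Q → ZMod 2, C.HX *ᵥ v = 0 ∧ v ∉ C.rowSpZ)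
    (h : ∀ v : Q → ZMod 2, C.HX *ᵥ v = 0 → v ∉ C.rowSpZ → d ≤ hammingNorm v) : d ≤ C.dZ :=
  C.swap.le_dX hex h

/-- **The certificate lemma for `d^X`**: an explicit `X`-logical `v` of weight `d` together with the
universally checked statement "every `X`-logical has weight `≥ d`" gives `d^X = d` — the shape
`(upper witness, lower bound)` of a distance certificate. [cite: BravyiEtAl2024, §4, proof of Lemma 1] -/
theorem dX_eq_of_witness [Fintype RX] (C : CSSCode RX RZ Q) {d : ℕ} {v : Q → ZMod 2} (hv : C.HZ *ᵥ v = 0)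
    (hv' : v ∉ C.rowSpX) (hwt : hammingNorm v = d)
    (h : ∀ w : Q → ZMod 2, C.HZ *ᵥ w = 0 → w ∉ C.rowSpX → d ≤ hammingNorm w) : C.dX = d :=
  le_antisymm (hwt ▸ C.dX_le_hammingNorm hv hv') (C.le_dX ⟨v, hv, hv'⟩ h)

/-- The certificate lemma for `d^Z`. [cite: BravyiEtAl2024, §4, proof of Lemma 1] -/
theorem dZ_eq_of_witness [Fintype RZ] (C : CSSCode RX RZ Q) {d : ℕ} {v : Q → ZMod 2} (hv : C.HX *ᵥ v = 0)
    (hv' : v ∉ C.rowSpZ) (hwt : hammingNorm v = d)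
    (h : ∀ w : Q → ZMod 2, C.HX *ᵥ w = 0 → w ∉ C.rowSpZ → d ≤ hammingNorm w) : C.dZ = d :=
  C.swap.dX_eq_of_witness hv hv' hwt h

/-- `d^X` is attained: if an `X`-logical exists, some `X`-logical has weight exactly `d^X`.
[cite: BravyiEtAl2024, §4 Lemma 1 and proof (arXiv chunk p0009 L109-117: d^X, d^Z as minima over ker ∖ rs)] -/
theorem exists_hammingNorm_eq_dX [Fintype RX] (C : CSSCode RX RZ Q)
    (hex : ∃ v : Q → ZMod 2, C.HZ *ᵥ v = 0 ∧ v ∉ C.rowSpX) :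
    ∃ v : Q → ZMod 2, C.HZ *ᵥ v = 0 ∧ v ∉ C.rowSpX ∧ hammingNorm v = C.dX := by
  obtain ⟨v, hv, hv'⟩ := hex
  obtain ⟨w, ⟨hw, hw'⟩, hwd⟩ :=
    Nat.sInf_mem (s := hammingNorm '' ((C.kerZ : Set (Q → ZMod 2)) \ C.rowSpX)) ⟨_, v, ⟨hv, hv'⟩, rfl⟩
  exact ⟨w, hw, hw', hwd⟩

/-- `d^Z` is attained. [cite: BravyiEtAl2024, §4 Lemma 1 and proof (arXiv chunk p0009 L109-117: d^X, d^Z as minima over ker ∖ rs)] -/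
theorem exists_hammingNorm_eq_dZ [Fintype RZ] (C : CSSCode RX RZ Q)
    (hex : ∃ v : Q → ZMod 2, C.HX *ᵥ v = 0 ∧ v ∉ C.rowSpZ) :
    ∃ v : Q → ZMod 2, C.HX *ᵥ v = 0 ∧ v ∉ C.rowSpZ ∧ hammingNorm v = C.dZ :=
  C.swap.exists_hammingNorm_eq_dX hex

/-- Below the `X`-distance every `X`-logical candidate is a stabilizer: `H^Z v = 0`, `|v| < d^X ⟹
v ∈ rs H^X`. [cite: Gottesman1997, §3.2 ("the code will have distance d iff N(S) − S contains no elements of weight less than d")] -/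
theorem mem_rowSpX_of_hammingNorm_lt_dX [Fintype RX] (C : CSSCode RX RZ Q) {v : Q → ZMod 2} (hv : C.HZ *ᵥ v = 0)
    (hlt : hammingNorm v < C.dX) : v ∈ C.rowSpX := by
  by_contra hv'
  exact absurd hlt (not_lt.2 (C.dX_le_hammingNorm hv hv'))

/-- **When `d^X` is positive** (i.e. not the junk value): iff the code has an `X`-type logical operator.
[cite: BravyiEtAl2024, §4 Lemma 1 and proof (arXiv chunk p0009 L109-117: d^X, d^Z as minima over ker ∖ rs)] -/
theorem dX_pos_iff [Fintype RX] (C : CSSCode RX RZ Q) :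
    0 < C.dX ↔ ∃ v : Q → ZMod 2, C.HZ *ᵥ v = 0 ∧ v ∉ C.rowSpX := by
  constructor
  · intro h
    by_contra hne
    push Not at hne
    have : hammingNorm '' ((C.kerZ : Set (Q → ZMod 2)) \ C.rowSpX) = ∅ := by
      ext d
      simp only [Set.mem_image, Set.mem_sdiff, SetLike.mem_coe, Set.mem_empty_iff_false, iff_false,
        not_exists, not_and, and_imp]
      exact fun w hw hw' _ => hw' (hne w hw)
    rw [dX, this, Nat.sInf_empty] at h
    exact lt_irrefl 0 h
  · intro hex
    obtain ⟨v, _, hv', hvd⟩ := C.exists_hammingNorm_eq_dX hex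
    rw [← hvd]
    exact C.hammingNorm_pos_of_not_mem_rowSpX hv'

/-- `d^Z` is positive iff a `Z`-logical exists. [cite: BravyiEtAl2024, §4 Lemma 1 and proof (arXiv chunk p0009 L109-117: d^X, d^Z as minima over ker ∖ rs)] -/
theorem dZ_pos_iff [Fintype RZ] (C : CSSCode RX RZ Q) :
    0 < C.dZ ↔ ∃ v : Q → ZMod 2, C.HX *ᵥ v = 0 ∧ v ∉ C.rowSpZ :=
  C.swap.dX_pos_iff

/-- `d^X = 0` (junk) iff `ker H^Z = rs H^X` (no `X`-logical). [cite: BravyiEtAl2024, §4 Lemma 1 and proof (arXiv chunk p0009 L109-117: d^X, d^Z as minima over ker ∖ rs)] -/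
theorem dX_eq_zero_iff [Fintype RX] (C : CSSCode RX RZ Q) : C.dX = 0 ↔ C.kerZ = C.rowSpX := by
  rw [← not_iff_not, ← Ne, ← pos_iff_ne_zero, dX_pos_iff]
  constructor
  · rintro ⟨v, hv, hv'⟩ heq
    exact hv' (heq ▸ hv)
  · intro hne
    by_contra hall
    push Not at hall
    exact hne (le_antisymm (fun v hv => hall v hv) C.rowSpX_le_kerZ)

end Distances

/-! ### The number of logical qubits -/

section Dimension

/-- The **number of logical qubits** `k = dim (ker H^Z) − dim (rs H^X)`: the dimension of
`ker H^Z / rs H^X` (`X`-type logical operators modulo `X`-stabilizers) — Nielsen–Chuang's `k₁ − k₂` for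
`CSS(C₁, C₂)`, `C₁ = ker H^Z ⊇ C₂ = rs H^X` (the `ℕ`-subtraction never truncates, `rowSpX_le_kerZ`).
The printed closed form `k = n − rank H^X − rank H^Z` is `k_eq`.
[cite: NielsenChuang2010, §10.4.2 p. 450 ("CSS(C₁,C₂) is an [n, k₁ − k₂] quantum code")] -/
noncomputable def k [Fintype RX] (C : CSSCode RX RZ Q) : ℕ :=
  Module.finrank (ZMod 2) C.kerZ - Module.finrank (ZMod 2) C.rowSpX

/-- `rank H^X + rank H^Z ≤ n` for a CSS code (so `n − rank H^X − rank H^Z` is an honest difference).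
[cite: NielsenChuang2010, §10.4.2 p. 450 (C₂ ⊂ C₁, an [n, k₁ − k₂] code)] -/
theorem rank_HX_add_rank_HZ_le [Fintype RX] (C : CSSCode RX RZ Q) :
    C.HX.rank + C.HZ.rank ≤ Fintype.card Q :=
  rank_add_rank_le_of_rowSpace_le_pcCode C.rowSpX_le_kerZ

/-- **`k = n − rank H^X − rank H^Z`**, `n = |Q|` ("It is known [Steane 1996, Calderbank–Shor 1996]
that `k = n − rk H^X − rk H^Z`"), by rank–nullity for `H^Z` and row rank = rank for `H^X`.
[cite: BravyiEtAl2024, §4, proof of Lemma 1 ("k = n − rk(H^X) − rk(H^Z)")] -/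
theorem k_eq [Fintype RX] (C : CSSCode RX RZ Q) :
    C.k = Fintype.card Q - C.HX.rank - C.HZ.rank := by
  have h1 := rank_add_finrank_pcCode C.HZ
  have h2 := finrank_rowSpace_eq_rank C.HX
  rw [k, kerZ, rowSpX, h2]
  omega

/-- `k` is symmetric under the `X ↔ Z` exchange: counting `Z`-logicals modulo `Z`-stabilizers gives
the same number, `dim (ker H^X) − dim (rs H^Z) = k`. [cite: Gottesman1997, §3.3 (the two parity check matrices P (Z's) and Q ("only now with X's instead of Z's") enter symmetrically)] -/
theorem k_swap [Fintype RX] [Fintype RZ] (C : CSSCode RX RZ Q) : C.swap.k = C.k := by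
  rw [k_eq, k_eq]
  change Fintype.card Q - C.HZ.rank - C.HX.rank = Fintype.card Q - C.HX.rank - C.HZ.rank
  omega

/-- `k = 0` iff there is no `X`-logical, iff `d^X = 0` (the junk value). [cite: NielsenChuang2010, §10.4.2 p. 450 (C₂ ⊂ C₁, an [n, k₁ − k₂] code)] -/
theorem k_eq_zero_iff_dX_eq_zero [Fintype RX] (C : CSSCode RX RZ Q) : C.k = 0 ↔ C.dX = 0 := by
  rw [dX_eq_zero_iff, k, Nat.sub_eq_zero_iff_le]
  refine ⟨fun h => (Submodule.eq_of_le_of_finrank_le C.rowSpX_le_kerZ h).symm, fun h => ?_⟩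
  exact le_of_eq (congrArg (fun S : Submodule (ZMod 2) (Q → ZMod 2) => Module.finrank (ZMod 2) S) h)

/-- Hence `d^X = 0 ↔ d^Z = 0` (both say `k = 0`). [cite: Gottesman1997, §3.3 (the two parity check matrices P (Z's) and Q ("only now with X's instead of Z's") enter symmetrically)] -/
theorem dX_eq_zero_iff_dZ_eq_zero [Fintype RX] [Fintype RZ] (C : CSSCode RX RZ Q) : C.dX = 0 ↔ C.dZ = 0 := by
  rw [← k_eq_zero_iff_dX_eq_zero, ← dX_swap, ← k_eq_zero_iff_dX_eq_zero, k_swap]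

/-- With `k > 0` both distances are positive. [cite: BravyiEtAl2024, §4 Lemma 1 and proof (arXiv chunk p0009 L109-117: d^X, d^Z as minima over ker ∖ rs)] -/
theorem dX_pos_of_k_pos [Fintype RX] (C : CSSCode RX RZ Q) (hk : 0 < C.k) : 0 < C.dX := by
  rw [pos_iff_ne_zero] at hk ⊢
  exact fun h => hk ((k_eq_zero_iff_dX_eq_zero C).2 h)

/-- With `k > 0`, `d^Z > 0`. [cite: BravyiEtAl2024, §4 Lemma 1 and proof (arXiv chunk p0009 L109-117: d^X, d^Z as minima over ker ∖ rs)] -/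
theorem dZ_pos_of_k_pos [Fintype RX] [Fintype RZ] (C : CSSCode RX RZ Q) (hk : 0 < C.k) : 0 < C.dZ := by
  rw [← dX_swap]
  exact C.swap.dX_pos_of_k_pos (C.k_swap.symm ▸ hk)

end Dimension

/-! ### Link with Tillich–Zémor's `ℕ∞`-valued CSS minimum distance -/

section MinDist

/-- For `k > 0` the Tillich–Zémor minimum distance of the pair `(H^X, H^Z)` is `min (d^X, d^Z)`:
`cssMinDist H^X H^Z = ↑(min dX dZ)`. [cite: BravyiEtAl2024, §4, proof of Lemma 1 ("d = min(d^X, d^Z)")]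
[cite: TillichZemor2014, §2 (arXiv v1 chunk p0004 L9-18: "the minimum weight of the non-zero vectors that are either in C_X but not in C_Z^⊥ or in C_Z but not in C_X^⊥")] -/
theorem cssMinDist_eq_min_dX_dZ [Fintype RX] [Fintype RZ] (C : CSSCode RX RZ Q) (hk : 0 < C.k) :
    cssMinDist C.HX C.HZ = ((min C.dX C.dZ : ℕ) : ℕ∞) := by
  refine le_antisymm ?_ (le_cssMinDist_iff.2 fun e he => ?_)
  · obtain ⟨v, hv, hv', hvd⟩ := C.exists_hammingNorm_eq_dX ((C.dX_pos_iff).1 (C.dX_pos_of_k_pos hk))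
    obtain ⟨w, hw, hw', hwd⟩ := C.exists_hammingNorm_eq_dZ ((C.dZ_pos_iff).1 (C.dZ_pos_of_k_pos hk))
    rcases min_choice C.dX C.dZ with h | h <;> rw [h]
    · exact hvd ▸ cssMinDist_le_hammingNorm (Or.inr ⟨hv, hv'⟩)
    · exact hwd ▸ cssMinDist_le_hammingNorm (Or.inl ⟨hw, hw'⟩)
  · rcases he with ⟨he, he'⟩ | ⟨he, he'⟩
    · exact Nat.cast_le.2 ((min_le_right _ _).trans (C.dZ_le_hammingNorm he he'))
    · exact Nat.cast_le.2 ((min_le_left _ _).trans (C.dX_le_hammingNorm he he'))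

/-- For `k = 0` (no logical operator at all) the Tillich–Zémor minimum distance is `⊤` ("the minimum
distance of a code reduced to the all-zero codeword is ∞") while `dX = dZ = 0` are junk values.
[cite: TillichZemor2014, §5 (arXiv v1 chunk p0008 L3-4)] -/
theorem cssMinDist_eq_top [Fintype RX] [Fintype RZ] (C : CSSCode RX RZ Q) (hk : C.k = 0) : cssMinDist C.HX C.HZ = ⊤ := by
  have hX : C.kerZ = C.rowSpX := (C.dX_eq_zero_iff).1 ((C.k_eq_zero_iff_dX_eq_zero).1 hk)
  have hZ : C.kerX = C.rowSpZ :=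
    (C.swap.dX_eq_zero_iff).1 ((C.swap.k_eq_zero_iff_dX_eq_zero).1 (C.k_swap.trans hk))
  refine top_le_iff.1 (le_cssMinDist_iff.2 fun e he => ?_)
  rcases he with ⟨he, he'⟩ | ⟨he, he'⟩
  · exact absurd (hZ ▸ he : e ∈ C.rowSpZ) he'
  · exact absurd (hX ▸ he : e ∈ C.rowSpX) he'

end MinDist

end CSSCode

end Literature.InformationTheory.QuantumCodes
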